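import Summits.AnomalousDissipation.AnomalousDissipation.Theorems.SolenoidalFractalHomogenisationLagrangianStepVmodFsGridRows
import Summits.AnomalousDissipation.AnomalousDissipation.Theorems.SolenoidalFractalHomogenisationLagrangianStepVmodFsPeriodWindow
import Summits.AnomalousDissipation.AnomalousDissipation.Theorems.SolenoidalFractalHomogenisationLagrangianStepVmodFsPhaseZero
import HarnessLib

/-!
# K1L_D (stmt-AnomalousDissipation-27980): (V_mod) flat stage, block (fs) — THE ASSEMBLY ON GRID-ANCHORED WINDOWS
# (`Bfs` in the `BlockBound` currency at every exponent `0 ≤ e ≤ min(σ/2, 1/2)`, for all windows `[s,t]` starting on the cell grid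
# `s ∈ (M·W.period/ν)·ℕ` — the family of record of RULING D28-9; constants bookkeeping part 2/2; prover ad-k1loc-p3 g11, `--supports 27980 --as helper`)

No new analysis: the dispatch of one grid-anchored instance of the (fs) block onto the landed window theorems and the per-label rows of
part 1/2 (`…VmodFsGridRows.fs_row_of_grid`).
* §3 **`fs_pairing_le_grid`** — the (fs) pairing bound on EVERY window from a grid start, constants as hypotheses: unsaturated windows →
  `fs_pairing_le_of_short_window` (p714276); saturated and `t − s ≤ P` → `fs_pairing_le_of_window_le_period` (p718162); saturated and
  `t − s ≥ P` → the row assembler `fs_pairing_le_of_rows` (p719619) over `fs_row_of_grid`; the mean of the slow test is removed first by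
  `fs_inner_eq_inner_slowNZ` (p715688).  Allowance `C₃(C₃(ν^e + (⌈K/ν⌉₊/n)^e) + (min 1 (P/(t−s)))^e)` with `C₃ = 2C₁`.
* §4 **`exists_fs_blockBound_grid`** — THE GRID (fs) BLOCK: under the binder list of `Bfs_textEVH` ((V) clause + W7 family) and for every
  `0 ≤ e ≤ min(σ/2, 1/2)` there is `C₃ ≥ 0` such that the `BlockBound … e C₃ ν₀ K IsFast IsSlow` inequality holds on all windows with
  `(∃ j : ℕ, s = j·(M·W.period/ν))` (binder inserted after `t ≤ Tw`, the convention of p1 g15's `ssMode_grid`); **`exists_fs_blockBound_grid_half`**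
  is the instance `e = min(σ/2)(1/2)` of the texts of record.  Constants: `g₀` from `exists_small_scale`, `Kb = (K+1)/g₀` into the W7 family,
  `C₁ = 1 + Σ(seven thresholds)`, `C₃ = 2C₁`.  The grid-phase text `Bfs_textEVHP` (RULING D28-9, to be typed in `…VmodFlatBlocksP`) follows by a
  one-line bridge once it lands; the general-phase `Bfs_textEVH` additionally needs the head reduction `norm_fc_le_of_head_reduction` (p719906)
  on coarse labels and is NOT claimed here.
`sorry`-free; NOT a proof of `stub_Vmod_EHTthg`, of K1L_D or of AD; rung F-D1.A0.
-/

set_option linter.dupNamespace false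

noncomputable section

namespace Summit.AnomalousDissipation.AnomalousDissipation.Theorems.SolenoidalFractalHomogenisation.LagrangianStep.VmodFlat

open Literature.Analysis Literature.Analysis.FluidPDE Literature.Analysis.FunctionSpaces
open MeasureTheory Set Filter UnitAddTorus
open scoped ENNReal NNReal InnerProductSpace
open Summit.AnomalousDissipation.AnomalousDissipation.Theorems.SolenoidalFractalHomogenisation.LagrangianStep.CellClauseMod
open Summit.AnomalousDissipation.AnomalousDissipation.Theorems.SolenoidalFractalHomogenisation.LagrangianStep.LossCurrency
open Summit.AnomalousDissipation.AnomalousDissipation.Theorems.SolenoidalFractalHomogenisation.LagrangianStep.Sideband (slotAmp)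

/-! ## §3 The (fs) pairing bound on all windows from a grid start (constants as hypotheses) -/

set_option maxHeartbeats 4000000 in
/-- **THE (fs) PAIRING ON EVERY WINDOW FROM A GRID START** (constants as hypotheses).  See the module docstring. -/
theorem fs_pairing_le_grid {k : ℕ} (W : LatticeShear.LatticeWord k) (M : ℝ) (hM : 0 < M) {c : ℝ} (hc : 0 < c)
    (Φ : ℝ → Torus.Visc4 (Fin 3) → Torus.Visc4 (Fin 3)) {lo hi Λ β σ C ν₀ K : ℝ}
    (hlo : 0 < lo) (hhi : 1 ≤ hi) (hΛ : 1 < Λ) (hβ : 0 ≤ β) (hσ : 0 < σ) (hC : 0 ≤ C) (hν₀ : ν₀ ≤ 1) (hK : 0 < K)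
    (hV : SlowVectorClauseF W M hM c Φ lo hi Λ β σ C ν₀ K)
    {g₀ : ℝ} (hg₀ : 0 < g₀) (hg₀1 : g₀ ≤ 1)
    (hgσ : 2 * Real.sqrt 2 * C ^ 2 * g₀ ^ σ ≤ 1 / 50)
    (hA : 8 * Real.pi ^ 2 * (lo / Λ) * (M * W.period) * (1 + c) / K ^ 2 * g₀
      ≤ 1 / (50 * (2 * Real.sqrt 2 * C * (hi * Λ ^ 2 / lo) + 1)))
    (hB : 12 * k * Real.exp (9 * (k : ℝ) ^ 2 / (2 * Real.pi ^ 4 * (lo / Λ) ^ 2 * c)) / (Real.pi ^ 2 * (lo / Λ) * K) * g₀ ≤ 1 / 50)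
    (hBs : 24 * (∑ j, ‖slotAmp W j‖) / (Real.pi * (lo / Λ) * K) * g₀ ≤ 1 / 50)
    (hgd : 16 * (1 + c) * g₀ / K ^ 2 ≤ 1 / 50)
    {νh CK cK : ℝ} (hH : HighLabelDecayW W M hM lo hi Λ β νh ((K + 1) / g₀) CK cK) (hCK : 1 ≤ CK) (hcK : 0 < cK) (hνh : 0 < νh)
    {ν : ℝ} (hν : ν ∈ Set.Ioo 0 ν₀) {n : ℕ} (hn : (⌈K / ν⌉₊ : ℝ) ≤ n) {𝔸 : Torus.Visc4 (Fin 3)}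
    (hodd : Torus.OddSmall 𝔸 (ν * β)) (hwin : ∃ lam ∈ Set.Icc (1:ℝ) Λ, Torus.NearIso 𝔸 (ν * (lo / lam)) (ν * (hi * lam)))
    (hΦw : ∃ lam ∈ Set.Icc (1:ℝ) Λ, Torus.NearIso (Φ ν ((1 / ν) • 𝔸)) (lo / lam) (hi * lam))
    {Tw : ℝ} {U T : ℝ → ℝ → (V2 →L[ℝ] V2)}
    (hU : Torus.IsPropagator Tw (cellField W M hM ν hν.1 n) ((1 / (n:ℝ) ^ 2) • 𝔸) U)
    (hT : Torus.IsPropagator Tw (fun _ _ => 0) ((1 / (n:ℝ) ^ 2) • (𝔸 + (c / ν) • Φ ν ((1 / ν) • 𝔸))) T)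
    {s t : ℝ} (j : ℕ) (hsj : s = j * (M * W.period / ν)) (hst : s < t) (htT : t ≤ Tw)
    {C₁ e : ℝ} (he0 : 0 ≤ e) (heσ : e ≤ σ / 2) (he12 : e ≤ 1 / 2) (hC₁1 : 1 ≤ C₁)
    (hC₁s : Λ * (k + hi * Λ + β) / (c * lo) ≤ C₁)
    (hC₁p : (3 * k + Real.pi ^ 2 * (hi * Λ + β / 2)) * Real.sqrt (M * W.period * Λ / (c * lo)) / Real.pi + 2 * Real.sqrt 2 ≤ C₁)
    (hC₁a : 2 * 265 * (2 * Real.sqrt 2) * C ^ 2 ≤ C₁)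
    (hC₁b : 4 * 265 * (2 * Real.sqrt 2 * C ^ 2 * ((K + 1) ^ 2 / (8 * Real.pi ^ 2 * (lo / Λ) * (M * W.period) * c)) ^ (σ / 2)
        + 2 * Real.sqrt 2 * C * (hi * Λ ^ 2 / lo)
        + 12 * k * Real.exp (9 * (k : ℝ) ^ 2 / (2 * Real.pi ^ 4 * (lo / Λ) ^ 2 * c))
            / (Real.pi ^ 2 * (lo / Λ) * Real.sqrt (8 * Real.pi ^ 2 * (lo / Λ) * (M * W.period) * c))) ≤ C₁)
    (hC₁f : 1 / (g₀ ^ e * Real.sqrt (1 / 2)) ≤ C₁)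
    (hC₁h : Real.sqrt CK * Real.exp (cK * (M * W.period))
        / (cK * (M * W.period) * Real.sqrt ((1 / 2) * min 1 (8 * Real.pi ^ 2 * (lo / Λ) * (M * W.period) * c * g₀ ^ 2 / (K + 1) ^ 2))) ≤ C₁)
    (hC₁g : 1 / (νh ^ e * Real.sqrt ((1 / 2) * min 1 (8 * Real.pi ^ 2 * (lo / Λ) * (M * W.period) * c * g₀ ^ 2 / (K + 1) ^ 2))) ≤ C₁)
    (x ζ : V2) (hx : IsFast n x) (hζ : IsSlow n ζ) :
    |⟪U s t x - T s t x, ζ⟫_ℝ|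
      ≤ ((2 * C₁) * ((2 * C₁) * (ν ^ e + ((⌈K / ν⌉₊ : ℝ) / n) ^ e) + (min 1 ((M * W.period / ν) / (t - s))) ^ e))
        * Real.sqrt (lossFwd (T s t) x) * Real.sqrt (lossAdj (T s t) ζ) := by
  have hν0 : 0 < ν := hν.1
  have hν1 : ν ≤ 1 := hν.2.le.trans hν₀
  have hWp := Summit.AnomalousDissipation.AnomalousDissipation.Theorems.SolenoidalFractalHomogenisation.PermissibleCarrier.period_pos W
  have hMW : 0 < M * W.period := mul_pos hM hWp
  have hP0 : 0 < M * W.period / ν := div_pos hMW hν0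
  have hτ0 : 0 < t - s := sub_pos.2 hst
  have hs : 0 ≤ s := by rw [hsj]; positivity
  have hPτ0 : 0 ≤ (M * W.period / ν) / (t - s) := div_nonneg hP0.le hτ0.le
  have hC₁0 : 0 ≤ C₁ := by linarith
  have hνe0 : 0 ≤ ν ^ e := Real.rpow_nonneg hν0.le e
  have hue0 : 0 ≤ ((⌈K / ν⌉₊ : ℝ) / n) ^ e := Real.rpow_nonneg (by positivity) e
  have hme0 : 0 ≤ (min 1 ((M * W.period / ν) / (t - s))) ^ e := Real.rpow_nonneg (le_min zero_le_one hPτ0) e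
  set a : ℝ := ν ^ e + ((⌈K / ν⌉₊ : ℝ) / n) ^ e with ha
  set m : ℝ := (min 1 ((M * W.period / ν) / (t - s))) ^ e with hm
  have ha0 : 0 ≤ a := by rw [ha]; linarith
  have hm0 : 0 ≤ m := hme0
  have hF0 : 0 ≤ Real.sqrt (lossFwd (T s t) x) := Real.sqrt_nonneg _
  have hA0 : 0 ≤ Real.sqrt (lossAdj (T s t) ζ) := Real.sqrt_nonneg _
  -- the allowance is at least `C₁·ν^e`, `2C₁`, and twice the row allowance
  have hAν : C₁ * ν ^ e ≤ (2 * C₁) * ((2 * C₁) * a + m) := by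
    have h1 : ν ^ e ≤ a := by rw [ha]; linarith
    nlinarith [mul_nonneg hC₁0 hνe0, mul_nonneg hC₁0 hm0, mul_nonneg hC₁0 (sub_nonneg.2 h1)]
  by_cases hshort : 8 * Real.pi ^ 2 * loT lo Λ c ν n * ((n / 4 : ℕ) : ℝ) ^ 2 * (t - s) ≤ 1
  · -- unsaturated window: the generator row, ν-small constant
    have h := fs_pairing_le_of_short_window W M hM hc Φ hlo hhi hΛ hβ hν₀ hK hν hn hodd hwin hΦw hU hT hs hst htT x ζ hx hζ hshort
    refine h.trans (mul_le_mul_of_nonneg_right (mul_le_mul_of_nonneg_right ?_ hF0) hA0)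
    have hY0 : 0 ≤ Λ * (k + hi * Λ + β) / (c * lo) := by positivity
    have hνν : ν ≤ ν ^ e := Real.self_le_rpow_of_le_one hν0.le hν1 (by linarith)
    calc ν * Λ * (k + hi * Λ + β) / (c * lo) = (Λ * (k + hi * Λ + β) / (c * lo)) * ν := by ring
      _ ≤ C₁ * ν ^ e := mul_le_mul hC₁s hνν hν0.le hC₁0
      _ ≤ _ := hAν
  · have hsat : 1 ≤ 8 * Real.pi ^ 2 * loT lo Λ c ν n * ((n / 4 : ℕ) : ℝ) ^ 2 * (t - s) := le_of_lt (not_le.1 hshort)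
    -- remove the mean of the slow test
    obtain ⟨ζ', hζ', hpair, hloss⟩ := fs_inner_eq_inner_slowNZ W M hM hc Φ hlo hΛ hK hν hn hwin hΦw hU hT hs hst htT x ζ hx hζ
    rw [hpair]
    have hA0' : 0 ≤ Real.sqrt (lossAdj (T s t) ζ') := Real.sqrt_nonneg _
    have key : |⟪U s t x - T s t x, ζ'⟫_ℝ| ≤ ((2 * C₁) * ((2 * C₁) * a + m)) * Real.sqrt (lossFwd (T s t) x) * Real.sqrt (lossAdj (T s t) ζ') := by
      by_cases hτP : t - s ≤ M * W.period / ν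
      · -- at most one period: the any-phase period window
        have h := fs_pairing_le_of_window_le_period W M hM hc Φ hlo hhi hΛ hβ hν₀ hK hν hn hodd hwin hΦw hU hT hs hst htT hτP x ζ' hx hζ' hsat
        refine h.trans (mul_le_mul_of_nonneg_right (mul_le_mul_of_nonneg_right ?_ hF0) hA0')
        have hm1 : m = 1 := by
          rw [hm, min_eq_left ((one_le_div hτ0).2 hτP), Real.one_rpow]
        rw [hm1]
        nlinarith [mul_nonneg hC₁0 ha0]
      · -- beyond one period: the row assembler over the dispatch of §2
        have hτP' : M * W.period / ν ≤ t - s := le_of_lt (not_le.1 hτP)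
        have halw0 : 0 ≤ C₁ * (C₁ * a + m) := by positivity
        have h := fs_pairing_le_of_rows W M hM hc Φ hlo hhi hΛ hK hν hn hwin hΦw hU hT hs hst htT x ζ' hx hζ' hsat halw0
          (fun ℓ hℓ v hv hvs hv1 hv2 => fs_row_of_grid W M hM hc Φ hlo hhi hΛ hσ hC hν₀ hK hV hg₀ hg₀1 hgσ hA hB hBs hgd hH hCK hcK hνh
            hν hn hodd hwin hΦw hU hT j hsj hst htT hτP' he0 heσ he12 hC₁1 hC₁a hC₁b hC₁f hC₁h hC₁g hℓ v hv hvs hv1 hv2)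
        refine h.trans (mul_le_mul_of_nonneg_right (mul_le_mul_of_nonneg_right ?_ hF0) hA0')
        nlinarith [mul_nonneg (mul_nonneg hC₁0 hC₁0) ha0]
    exact key.trans (mul_le_mul_of_nonneg_left (Real.sqrt_le_sqrt hloss) (by positivity))

/-! ## §4 The grid (fs) block: existence of the constant -/

set_option maxHeartbeats 4000000 in
/-- **THE (fs) BLOCK ON GRID-ANCHORED WINDOWS** (binder list of `Bfs_textEVH`; window binder `(∃ j : ℕ, s = j·(M·W.period/ν))` inserted after
`t ≤ Tw`, as in p1 g15's `ssMode_grid`): for every `0 ≤ e ≤ min(σ/2, 1/2)` there is `C₃ ≥ 0` with the `BlockBound … e C₃ ν₀ K IsFast IsSlow`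
inequality on all such windows.  Constants: `g₀` from `exists_small_scale`, `Kb = (K+1)/g₀` into the W7 family, `C₃ = 2·(1 + Σ thresholds)`. -/
theorem exists_fs_blockBound_grid {k : ℕ} (W : LatticeShear.LatticeWord k) (M : ℝ) (hM : 0 < M) {c : ℝ} (hc : 0 < c)
    (Φ : ℝ → Torus.Visc4 (Fin 3) → Torus.Visc4 (Fin 3)) {lo hi Λ β σ C ν₀ K : ℝ}
    (hlo : 0 < lo) (hhi : 1 ≤ hi) (hΛ : 1 < Λ) (hβ : 0 ≤ β) (hσ : 0 < σ) (hC : 0 ≤ C) (hν₀1 : ν₀ ≤ 1) (hK : 0 < K)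
    (hV : SlowVectorClauseF W M hM c Φ lo hi Λ β σ C ν₀ K)
    (hH : ∀ Kb : ℝ, 1 ≤ Kb → ∃ CK : ℝ, 1 ≤ CK ∧ ∃ cK > (0:ℝ), ∃ νh > (0:ℝ), HighLabelDecayW W M hM lo hi Λ β νh Kb CK cK)
    {e : ℝ} (he0 : 0 ≤ e) (heσ : e ≤ σ / 2) (he12 : e ≤ 1 / 2) :
    ∃ C₃ : ℝ, 0 ≤ C₃ ∧
    ∀ ν, ∀ hν : ν ∈ Set.Ioo 0 ν₀, ∀ n : ℕ, (⌈K / ν⌉₊ : ℝ) ≤ n → ∀ 𝔸 : Torus.Visc4 (Fin 3),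
      Torus.OddSmall 𝔸 (ν * β) → (∃ lam ∈ Set.Icc (1:ℝ) Λ, Torus.NearIso 𝔸 (ν * (lo / lam)) (ν * (hi * lam))) →
      Torus.OddSmall (Φ ν ((1 / ν) • 𝔸)) β → (∃ lam ∈ Set.Icc (1:ℝ) Λ, Torus.NearIso (Φ ν ((1 / ν) • 𝔸)) (lo / lam) (hi * lam)) →
      ∀ Tw > (0:ℝ), ∀ U T : ℝ → ℝ → (V2 →L[ℝ] V2),
        Torus.IsPropagator Tw (cellField W M hM ν hν.1 n) ((1 / (n:ℝ) ^ 2) • 𝔸) U →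
        Torus.IsPropagator Tw (fun _ _ => 0) ((1 / (n:ℝ) ^ 2) • (𝔸 + (c / ν) • Φ ν ((1 / ν) • 𝔸))) T →
      ∀ s t : ℝ, 0 ≤ s → s < t → t ≤ Tw → (∃ j : ℕ, s = j * (M * W.period / ν)) → ∀ x ζ : V2, IsFast n x → IsSlow n ζ →
        |⟪U s t x - T s t x, ζ⟫_ℝ|
          ≤ (C₃ * (C₃ * (ν ^ e + ((⌈K / ν⌉₊ : ℝ) / n) ^ e) + (min 1 ((M * W.period / ν) / (t - s))) ^ e))
            * Real.sqrt (lossFwd (T s t) x) * Real.sqrt (lossAdj (T s t) ζ) := by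
  have hΛ1 : 1 ≤ Λ := hΛ.le
  have hΛ0 : 0 < Λ := by linarith
  have hhi0 : 0 ≤ hi := by linarith
  have hloΛ : 0 < lo / Λ := div_pos hlo hΛ0
  have hWp := Summit.AnomalousDissipation.AnomalousDissipation.Theorems.SolenoidalFractalHomogenisation.PermissibleCarrier.period_pos W
  have hMW : 0 < M * W.period := mul_pos hM hWp
  -- ### the coarse scale `g₀`
  obtain ⟨g₀, hg₀, hg₀1, hgσ, hA, hB, hBs, hgd'⟩ := exists_small_scale (σ := σ)
    (X₁ := 2 * Real.sqrt 2 * C ^ 2) (X₂ := 8 * Real.pi ^ 2 * (lo / Λ) * (M * W.period) * (1 + c) / K ^ 2)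
    (X₃ := 12 * k * Real.exp (9 * (k : ℝ) ^ 2 / (2 * Real.pi ^ 4 * (lo / Λ) ^ 2 * c)) / (Real.pi ^ 2 * (lo / Λ) * K))
    (X₄ := 24 * (∑ j, ‖slotAmp W j‖) / (Real.pi * (lo / Λ) * K)) (X₅ := 16 * (1 + c) / K ^ 2)
    (δ₁ := 1 / 50) (δ₂ := 1 / (50 * (2 * Real.sqrt 2 * C * (hi * Λ ^ 2 / lo) + 1))) (δ₃ := 1 / 50) (δ₄ := 1 / 50) (δ₅ := 1 / 50)
    hσ (by positivity) (by positivity) (by positivity) (by positivity) (by positivity)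
    (by norm_num) (by positivity) (by norm_num) (by norm_num) (by norm_num)
  have hgd : 16 * (1 + c) * g₀ / K ^ 2 ≤ 1 / 50 := by
    rw [show 16 * (1 + c) * g₀ / K ^ 2 = 16 * (1 + c) / K ^ 2 * g₀ by ring]; exact hgd'
  -- ### the W7 instance at `Kb = (K+1)/g₀`
  have hKb : (1:ℝ) ≤ (K + 1) / g₀ := by
    rw [le_div_iff₀ hg₀]; nlinarith
  obtain ⟨CK, hCK, cK, hcK, νh, hνh, hHW⟩ := hH ((K + 1) / g₀) hKb
  -- ### the constant
  set θL : ℝ := 8 * Real.pi ^ 2 * (lo / Λ) * (M * W.period) * c * g₀ ^ 2 / (K + 1) ^ 2 with hθLdef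
  have hθL0 : 0 < θL := by rw [hθLdef]; positivity
  have hmθ : 0 < (1 / 2) * min 1 θL := by have : 0 < min 1 θL := lt_min one_pos hθL0; positivity
  set Y₁ : ℝ := Λ * (k + hi * Λ + β) / (c * lo) with hY₁
  set Y₂ : ℝ := (3 * k + Real.pi ^ 2 * (hi * Λ + β / 2)) * Real.sqrt (M * W.period * Λ / (c * lo)) / Real.pi + 2 * Real.sqrt 2 with hY₂
  set Y₃ : ℝ := 2 * 265 * (2 * Real.sqrt 2) * C ^ 2 with hY₃
  set Y₄ : ℝ := 4 * 265 * (2 * Real.sqrt 2 * C ^ 2 * ((K + 1) ^ 2 / (8 * Real.pi ^ 2 * (lo / Λ) * (M * W.period) * c)) ^ (σ / 2)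
        + 2 * Real.sqrt 2 * C * (hi * Λ ^ 2 / lo)
        + 12 * k * Real.exp (9 * (k : ℝ) ^ 2 / (2 * Real.pi ^ 4 * (lo / Λ) ^ 2 * c))
            / (Real.pi ^ 2 * (lo / Λ) * Real.sqrt (8 * Real.pi ^ 2 * (lo / Λ) * (M * W.period) * c))) with hY₄
  set Y₅ : ℝ := 1 / (g₀ ^ e * Real.sqrt (1 / 2)) with hY₅
  set Y₆ : ℝ := Real.sqrt CK * Real.exp (cK * (M * W.period)) / (cK * (M * W.period) * Real.sqrt ((1 / 2) * min 1 θL)) with hY₆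
  set Y₇ : ℝ := 1 / (νh ^ e * Real.sqrt ((1 / 2) * min 1 θL)) with hY₇
  have hY₁0 : 0 ≤ Y₁ := by rw [hY₁]; positivity
  have hY₂0 : 0 ≤ Y₂ := by rw [hY₂]; positivity
  have hY₃0 : 0 ≤ Y₃ := by rw [hY₃]; positivity
  have hY₄0 : 0 ≤ Y₄ := by
    rw [hY₄]
    have hX : 0 ≤ 2 * Real.sqrt 2 * C ^ 2 * ((K + 1) ^ 2 / (8 * Real.pi ^ 2 * (lo / Λ) * (M * W.period) * c)) ^ (σ / 2) :=
      mul_nonneg (by positivity) (Real.rpow_nonneg (by positivity) _)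
    positivity
  have hY₅0 : 0 ≤ Y₅ := by
    rw [hY₅]; exact div_nonneg zero_le_one (mul_nonneg (Real.rpow_nonneg hg₀.le e) (Real.sqrt_nonneg _))
  have hY₆0 : 0 ≤ Y₆ := by rw [hY₆]; positivity
  have hY₇0 : 0 ≤ Y₇ := by
    rw [hY₇]; exact div_nonneg zero_le_one (mul_nonneg (Real.rpow_nonneg hνh.le e) (Real.sqrt_nonneg _))
  set C₁ : ℝ := 1 + Y₁ + Y₂ + Y₃ + Y₄ + Y₅ + Y₆ + Y₇ with hC₁
  have hC₁1 : 1 ≤ C₁ := by rw [hC₁]; linarith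
  have h₁ : Y₁ ≤ C₁ := by rw [hC₁]; linarith
  have h₂ : Y₂ ≤ C₁ := by rw [hC₁]; linarith
  have h₃ : Y₃ ≤ C₁ := by rw [hC₁]; linarith
  have h₄ : Y₄ ≤ C₁ := by rw [hC₁]; linarith
  have h₅ : Y₅ ≤ C₁ := by rw [hC₁]; linarith
  have h₆ : Y₆ ≤ C₁ := by rw [hC₁]; linarith
  have h₇ : Y₇ ≤ C₁ := by rw [hC₁]; linarith
  refine ⟨2 * C₁, by linarith, ?_⟩
  intro ν hν n hn 𝔸 hodd hwin _hΦo hΦw Tw _hTw U T hU hT s t _hs hst htT hgrid x ζ hx hζ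
  obtain ⟨j, hsj⟩ := hgrid
  exact fs_pairing_le_grid W M hM hc Φ hlo hhi hΛ hβ hσ hC hν₀1 hK hV hg₀ hg₀1 hgσ hA hB hBs hgd hHW hCK hcK hνh hν hn hodd hwin hΦw hU hT
    j hsj hst htT he0 heσ he12 hC₁1 h₁ h₂ h₃ h₄ h₅ h₆ h₇ x ζ hx hζ

/-- **THE (fs) BLOCK OF RECORD ON THE GRID** — `exists_fs_blockBound_grid` at the exponent of the texts, `e = min(σ/2)(1/2)`: under the binder
list of `Bfs_textEVH`, `∃ C₃ ≥ 0` with the `BlockBound W M hM c Φ lo hi Λ β (min (σ/2) (1/2)) C₃ ν₀ K IsFast IsSlow` inequality on every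
window whose start lies on the cell grid `(M·W.period/ν)·ℕ` (∋ 0).  The grid-phase text `Bfs_textEVHP (fun σ => min (σ/2) (1/2))` of
RULING D28-9 is this statement up to the order of two binders. -/
theorem exists_fs_blockBound_grid_half {k : ℕ} (W : LatticeShear.LatticeWord k) (M : ℝ) (hM : 0 < M) {c : ℝ} (hc : 0 < c)
    (Φ : ℝ → Torus.Visc4 (Fin 3) → Torus.Visc4 (Fin 3)) {lo hi Λ β σ C ν₀ K : ℝ}
    (hlo : 0 < lo) (hhi : 1 ≤ hi) (hΛ : 1 < Λ) (hβ : 0 ≤ β) (hσ : 0 < σ) (hC : 0 ≤ C) (hν₀1 : ν₀ ≤ 1) (hK : 0 < K)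
    (hV : SlowVectorClauseF W M hM c Φ lo hi Λ β σ C ν₀ K)
    (hH : ∀ Kb : ℝ, 1 ≤ Kb → ∃ CK : ℝ, 1 ≤ CK ∧ ∃ cK > (0:ℝ), ∃ νh > (0:ℝ), HighLabelDecayW W M hM lo hi Λ β νh Kb CK cK) :
    ∃ C₃ : ℝ, 0 ≤ C₃ ∧
    ∀ ν, ∀ hν : ν ∈ Set.Ioo 0 ν₀, ∀ n : ℕ, (⌈K / ν⌉₊ : ℝ) ≤ n → ∀ 𝔸 : Torus.Visc4 (Fin 3),
      Torus.OddSmall 𝔸 (ν * β) → (∃ lam ∈ Set.Icc (1:ℝ) Λ, Torus.NearIso 𝔸 (ν * (lo / lam)) (ν * (hi * lam))) →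
      Torus.OddSmall (Φ ν ((1 / ν) • 𝔸)) β → (∃ lam ∈ Set.Icc (1:ℝ) Λ, Torus.NearIso (Φ ν ((1 / ν) • 𝔸)) (lo / lam) (hi * lam)) →
      ∀ Tw > (0:ℝ), ∀ U T : ℝ → ℝ → (V2 →L[ℝ] V2),
        Torus.IsPropagator Tw (cellField W M hM ν hν.1 n) ((1 / (n:ℝ) ^ 2) • 𝔸) U →
        Torus.IsPropagator Tw (fun _ _ => 0) ((1 / (n:ℝ) ^ 2) • (𝔸 + (c / ν) • Φ ν ((1 / ν) • 𝔸))) T →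
      ∀ s t : ℝ, 0 ≤ s → s < t → t ≤ Tw → (∃ j : ℕ, s = j * (M * W.period / ν)) → ∀ x ζ : V2, IsFast n x → IsSlow n ζ →
        |⟪U s t x - T s t x, ζ⟫_ℝ|
          ≤ (C₃ * (C₃ * (ν ^ (min (σ / 2) (1 / 2)) + ((⌈K / ν⌉₊ : ℝ) / n) ^ (min (σ / 2) (1 / 2)))
              + (min 1 ((M * W.period / ν) / (t - s))) ^ (min (σ / 2) (1 / 2))))
            * Real.sqrt (lossFwd (T s t) x) * Real.sqrt (lossAdj (T s t) ζ) :=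
  exists_fs_blockBound_grid W M hM hc Φ hlo hhi hΛ hβ hσ hC hν₀1 hK hV hH
    (le_min (by linarith) (by norm_num)) (min_le_left _ _) (min_le_right _ _)

end Summit.AnomalousDissipation.AnomalousDissipation.Theorems.SolenoidalFractalHomogenisation.LagrangianStep.VmodFlat

end
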